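import Summits.AtomisticToContinuum.FouriersLaw.Theses.EmbeddedDrudeMourre
import Summits.AtomisticToContinuum.FouriersLaw.Theses.KineticCorner
import Summits.AtomisticToContinuum.FouriersLaw.Theorems.EmbeddedDrudeMourreDrudeDissolutionOfKineticCruxes
import Summits.AtomisticToContinuum.FouriersLaw.Theorems.EmbeddedDrudeMourreDrudeDissolutionOfBmKineticCruxes
import Summits.AtomisticToContinuum.FouriersLaw.Theorems.EmbeddedDrudeMourreDrudeDissolutionIffMourre
import Summits.AtomisticToContinuum.FouriersLaw.Theorems.EmbeddedDrudeMourreFGRGap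

/-!
# Strategy census for crux `DrudeDissolution` (stmt-AtomisticToContinuum-12593) — typed companions

Crux-strategist seat `planner-cstrat-stmt-AtomisticToContinuum-12593-s1-0`, 2026-08-17.
This file only TYPES the objects named in `STRATEGY-CENSUS.md` (no new stubs, no new line):

* §S  the strengthenings S⁺ considered (`ExponentialKineticMixing`, `UniformKineticScaleBound`,
      `CornerGreenKubo`) as `Prop`s over existing declarations;
* §D  the best typed decomposition, whose glue is ALREADY LANDED (`example`s by name);
* §N  the negation obstruction (the proved odd-sector Fermi-golden-rule gap) by name;
* §E  the proved equivalence with the sibling crux `MourreDissolution` (stmt-12594).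
-/

noncomputable section

namespace Summit.AtomisticToContinuum.FouriersLaw.Cruxes.DrudeDissolution.StrategyCensus

open MeasureTheory
open Literature.MathematicalPhysics.KineticTheory.HeatConduction
open Summit.AtomisticToContinuum.FouriersLaw

/-! ## §S Strengthenings -/

/-- **S⁺₁ `ExponentialKineticMixing`** — the RIGID form of the crux's time side: an exponential
envelope at the kinetic rate for ALL times, for the canonical (Buttà–Marchioro) dynamics and the
shift-invariant DLR state: `|C_T(t)| ≤ A·T²·exp(−c·T²·t)` for every `t ≥ 0`, `T < T₀`.
It implies the existential post-kinetic tail (PKT∃) and, with the kinetic limit, the crux through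
the landed glue of §D. The census explains why it is PREDICTED FALSE (odd three-field hydrodynamic
channel: `t⁻²` tail, `|ω|`-kink of the density) and why, even if true, no semigroup/fixed-point
argument reaches it (no gapped Markov skeleton at fixed `T`). -/
def ExponentialKineticMixing : Prop :=
  ∀ ω₂ lam β γ : ℝ, 0 < ω₂ → 0 < lam → 0 < β → 0 < γ →
    ∃ A c T₀ : ℝ, 0 < A ∧ 0 < c ∧ 0 < T₀ ∧ ∀ T : ℝ, 0 < T → T < T₀ →
      ∃ (μ : Measure ChainConfig) (D : InfiniteChainDynamics (pinnedChain ω₂ lam β γ)),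
        (pinnedChain ω₂ lam β γ).IsChainGibbsMeasure T μ ∧
        MeasurePreserving (fun σ : ChainConfig => fun i : ℤ => σ (i + 1)) μ μ ∧
        D.carrier = (pinnedChain ω₂ lam β γ).bmGood ∧ D.PreservesMeasure μ ∧
        ∀ t : ℝ, 0 ≤ t → |D.currentCorrelation μ t| ≤ A * T ^ 2 * Real.exp (-(c * T ^ 2 * t))

/-- **S⁺₂ `UniformKineticScaleBound`** — T-UNIFORM Abelian boundedness of the current spectral
measure at the kinetic scale `T²` (the `F-a` half of dead line natural-scale's stub F, = the
half-derivative criterion at scale): `sup_{0<ν≤ν₀} ∫₀^∞ e^{−νT²t} C_T(t) dt ≤ K` with `K`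
independent of `T < T₀`. No atom and no divergent cusp AT SCALE `T²`, uniformly. Strictly more than
the crux needs at each `T` in one direction (uniformity), strictly less in another (no continuity,
no positivity); the census records why its only conceivable supplier is a T-uniform LAP, i.e. the
same wall plus an interchange of limits. -/
def UniformKineticScaleBound : Prop :=
  ∀ ω₂ lam β γ : ℝ, 0 < ω₂ → 0 < lam → 0 < β → 0 < γ →
    ∃ K ν₀ T₀ : ℝ, 0 < K ∧ 0 < ν₀ ∧ 0 < T₀ ∧ ∀ T : ℝ, 0 < T → T < T₀ →
      ∃ (μ : Measure ChainConfig) (D : InfiniteChainDynamics (pinnedChain ω₂ lam β γ)),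
        (pinnedChain ω₂ lam β γ).IsChainGibbsMeasure T μ ∧
        MeasurePreserving (fun σ : ChainConfig => fun i : ℤ => σ (i + 1)) μ μ ∧
        D.carrier = (pinnedChain ω₂ lam β γ).bmGood ∧ D.PreservesMeasure μ ∧
        ∀ ν : ℝ, 0 < ν → ν ≤ ν₀ →
          IntegrableOn (fun t : ℝ => Real.exp (-(ν * T ^ 2 * t)) * D.currentCorrelation μ t) (Set.Ioi 0) ∧
          |∫ t in Set.Ioi (0 : ℝ), Real.exp (-(ν * T ^ 2 * t)) * D.currentCorrelation μ t| ≤ K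

/-- **S⁺₃ `CornerGreenKubo`** — the `L¹` strengthening on the corner (clause (i) of route
KineticCorner's target stmt-3429 / FourierGreenKubo's 0703 restricted to `T < T₀`): SOME Gibbs state
and preserving dynamics have `HasGreenKubo` (absolutely convergent correlations, `C_T ∈ L¹(0,∞)`,
positive integral). Strictly stronger than the crux (Disproof §5 `exists_window_not_integrable`);
implies it by the landed `stub_integrableSpectralCriterion` + `stub_cosineBochner`. -/
def CornerGreenKubo : Prop :=
  ∀ ω₂ lam β γ : ℝ, 0 < ω₂ → 0 < lam → 0 < β → 0 < γ → ∃ T₀ : ℝ, 0 < T₀ ∧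
    ∀ T : ℝ, 0 < T → T < T₀ → ∃ μ : Measure ChainConfig,
      (pinnedChain ω₂ lam β γ).IsChainGibbsMeasure T μ ∧
      ∃ D : InfiniteChainDynamics (pinnedChain ω₂ lam β γ), D.PreservesMeasure μ ∧ D.HasGreenKubo μ T

/-! ## §D Decomposition — the best typed split; its glue is LANDED (nothing to prove here) -/

/-- The ∀-good-triple form: `PostKineticTail` (stmt-3430) → `KineticLimit` (stmt-3431) → crux. -/
example : Theses.KineticCorner.PostKineticTail → Theses.KineticCorner.KineticLimit →
    Theses.EmbeddedDrudeMourre.DrudeDissolution :=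
  Theorems.DrudeDissolution.LineSketch.drudeDissolution_of_postKineticTail_of_kineticLimit

/-- The existential canonical-dynamics form (U rigidity → PKT∃ → KL∃ → crux), also landed. -/
example := @Theorems.DrudeDissolution.LineSketch.drudeDissolution_of_bmRigidity_of_bmPostKineticTail_of_bmKineticLimit

/-! ## §E Equivalence with the sibling crux (stmt-12594), landed -/

example : Theses.EmbeddedDrudeMourre.DrudeDissolution ↔ Theses.EmbeddedDrudeMourre.MourreDissolution :=
  Theorems.DrudeDissolution.drudeDissolution_iff_mourreDissolution

/-! ## §N Negation — the obstruction met at order ε² is the PROVED odd-sector FGR gap -/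

example : Theses.EmbeddedDrudeMourre.FGRGap := Theorems.FGRGap_proof

example (ω₂ a b : ℝ) (hω : 0 < ω₂) (ha : 0 < a) (hb : 0 < b) :
    Literature.MathematicalPhysics.KineticTheory.PhononBoltzmann.HasOddSectorGap ω₂ a b :=
  Theorems.FGRGap_proof ω₂ a b hω ha hb

end Summit.AtomisticToContinuum.FouriersLaw.Cruxes.DrudeDissolution.StrategyCensus

end
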